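import Summits.QuantumFields.BalabanUV.Beta.GAN24.LayerTransportLiteralSocket
import Summits.QuantumFields.BalabanUV.Beta.GAN24.ChainTableLegTelescopeCell
import Summits.QuantumFields.BalabanUV.Beta.GAN24.TableSlotCoDress

/-!
# `BalabanUV.Beta.GAN24.LayerTransportFluxFreeSocket` — binder row G-an2-4 ∕ (CONV-C), W-slot CT-W, route «WC-TL» ∕ (Q-R) «QR-LL», row **(CC-INT) OF THE (Q-R)^{cc}
# RE-CUT** (RULING R-gan24p1-g29-2 (4); `QR-CC-DESIGN-v0.md` §1 (i) ∕ §2): **THE LITERAL's LAYER BOUND FOR A FLUX-FREE (INTERIOR-BORN) SUB-LETTER FROM THE PURE CELL AND TWO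
# KERNEL ONE-GAUGE CELLS ON THE CO-DRESSED LETTER** — on a flux-free letter `S` the whole dressed chain of table legs is the one-shot dressed composite column (leaf-01 g67
# `ChainTableLegCoClosed` §3), whose block-mean window moves onto the letter (the owner's `TableSlotCoDress` §1): `push₃ T T T S = push₃ T T U (Πᵀ_bm S)` EXACTLY; so the
# END's `hLT` for `S` follows from the (UUU) cell ON `S̃ := coProjBmAtK ρ Lc S` (DISCHARGED, `LayerTransportUndressedThree`, modulo the letter-side rows OF `S̃`) and the two
# kernel one-gauge cells `push₃ (T−U) T U S̃`, `push₃ U (T−U) U S̃` (DISPLAYED — (ii-G)'s objects, undressed table leg) — «the base count once, then nothing» as a socket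
# (row owner `b2b-balaban-gan24-p1`, gen 30)

NOT IN PRINT; OUR BOOKKEEPING ([folklore] composition BY NAME: `ChainTableLegCoClosed.push₃_legChain_table_eq_respStepBm_of_fluxFree` ⨾ `RespStepBm.respStepBm_def` ⨾
`TableSlotCoDress.vertexW_bmW_eq` ⨾ `Push3LegTelescope.push₃_sub_left ∕ _sub_right` ⨾ `LayerTransportUndressedThree.biLoc_cubic_push₃_respStep_three` ⨾ leaf-12∕leaf-02's
envelopes `DressedLegEnvelope.exists_legChain_envelope` ∕ `RespStepSecondDiff.exists_respStep_decay_grad_diff2_l1` for the summable-class side conditions ⨾ an2's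
`AxialDressingRooted.locStencil_coProjBmAtK` (module `AxialDressingRootedBmDress`); 0 cited facts, 0 `def`, 0 `def … : Prop`, 0 sorry).  HONEST FRAMING (cell contract, verbatim): «discharging `BetaPertH`
makes Bałaban's UV stability UNCONDITIONAL — a real constructive-QFT result; it is NOT the continuum limit and NOT the Clay problem.»  HONEST DEPENDENCY (verbatim): «continuum YM
on T⁴ ⇐ BetaPertH ∧ nine spine estimates (0/9 proved); BetaPertH ⇐ (D1) ∧ (D4) ∧ CAP+tail; G-an2-4 gates asym, D1 and NE2/3/4.»

WHY.  The re-cut END `WardRemainderEndThreeCoDress.wLocStencil_unitS_coDress_three` asks the layer bound `hLT` only on the GOOD sub-letters.  The born letters of the literal are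
never co-closed (their slot divergence is the first-order T-EQ data) but the INTERIOR-label ones are FLUX-FREE (all `Lc`-block fluxes vanish: p2's star support + zero total;
engine E31∕E32: `max_B|Φ_B|∕sup|s| = 0.001`); for those this file is the socket: the table third of K-LL-4 costs exactly ONE dressing, carried by the letter as `S ↦ Πᵀ_bm S`
(`TableSlotCoDressCharge`: charge-free when flux-free; E31: the symmetric first moment is killed too, the magnetic one kept), and the remaining cells are KERNEL-leg cells.
THE LOCATED QUESTION this file displays and does not answer: the letter-side rows of the (UUU) cell FOR `S̃` — `LocStencil` ✓ (an2, derived here), the profile `hS̃ ∕ hω` and the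
charge rows `hQ hZ hM0 hP1` of `S̃` (displayed; (L1)∕(L3) give `hM0`; `hP1` is the (S)∕(INV) seats' row read on `S̃`).

WHAT (`d = 3`, `2 ≤ Lc`, in-block root `toSite rr`).  §1 `push₃_bmW_table_apply_eq` (window ↦ letter, pointwise, summable-row legs), **`push₃_legChain_eq_respStep_coProj_of_fluxFree`**
(`push₃ l r (legChain (respStepBmSeq ρ Lc) (m+1) k) S κ′ u′ = push₃ l r (respStep (Lc^(m+1)) (Lc^(m+1+k+1))) (coProjBmAtK ρ Lc S) κ′ u′` for flux-free local `S`, ANY kernel legs);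
§2 **`exists_hLT_literal_of_kernel_cells_of_fluxFree`**: `∃ κ₀ A A′ A″` (leaf-02's, level-free) such that for every `0 < κ ≤ κ₀`, every `(m,k)`, every local FLUX-FREE `S` whose
co-dressed letter `S̃ = coProjBmAtK ρ Lc S` meets the (LT-3) letter-side rows at `κ`, and ANY `K₁ K₂` with the two kernel one-gauge cells ON `S̃` (undressed table leg) bi-localised,
`BiLoc ((Lc^(k+1))^{12} • push₃ T T T S ν U₀) U₀ U₀ ((K₀ + K₁ + K₂)·(√(Lc^(k+1)))⁻¹·e^{−η‖y−U₀‖₁}) (κ∕4)` — the END's `hLT` for that sub-letter, `K₀` = the (UUU) cell's explicit constant.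
Discharges NOTHING of (Q-R) ∕ (LT) ∕ (LAY) ∕ (S) ∕ (DIV) ∕ (DL): the two kernel cells and `S̃`'s rows are DISPLAYED; NEVER «G-an2-4 closed» as (CONV-C); NOT D1, NOT `BetaPertH`, NOT
continuum, NOT Clay.  2026-08-22; no existing file touched.
-/

noncomputable section

open Finset
open scoped BigOperators
open Literature.MathematicalPhysics.QuantumFieldTheory
open Literature.MathematicalPhysics.QuantumFieldTheory.Balaban1983to89
open Literature.MathematicalPhysics.QuantumFieldTheory.Balaban1983to89.Beta
open B12Sec2to5 (l1 l1_nonneg)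
open B6BondElimination (unitVec)
open ExpKernelCalculus (MKer Site BiLoc Zl)
open KernelWard (biLoc_add divV)
open OneStepResolventKernel (Fib LocStencil)
open LatticeForm (quo)
open AffineAveraging (box toSite)
open BalabanCompositeJets (respStep)
open Summit.QuantumFields.BalabanUV.Beta.AxialDressingRooted (coProjBmAtK cKb' locStencil_coProjBmAtK)
open Summit.QuantumFields.BalabanUV.Beta.ChartConjugationReflection (abs_le_of_locStencil)
open Summit.QuantumFields.BalabanUV.Beta.GAN24.Push4Iter (LegFam legChain)
open Summit.QuantumFields.BalabanUV.Beta.GAN24.Push3 (push₃ push₃_def)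
open Summit.QuantumFields.BalabanUV.Beta.GAN24.RespStepBm (bmW respStepBm respStepBm_def)
open Summit.QuantumFields.BalabanUV.Beta.GAN24.RespStepBmDecompExact (respStepBmSeq)
open Summit.QuantumFields.BalabanUV.Beta.GAN24.Push4TwoRate (summable_leg)
open Summit.QuantumFields.BalabanUV.Beta.GAN24.Push3LegTelescope (abs_le_of_env' summable_of_env' push₃_sub_left push₃_sub_right)
open Summit.QuantumFields.BalabanUV.Beta.GAN24.DressedLegEnvelope (exists_legChain_envelope)
open Summit.QuantumFields.BalabanUV.Beta.GAN24.RespStepSecondDiff (exists_respStep_decay_grad_diff2_l1)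
open Summit.QuantumFields.BalabanUV.Beta.GAN24.LayerTransportUndressedThree (biLoc_cubic_push₃_respStep_three)
open Summit.QuantumFields.BalabanUV.Beta.GAN24.LayerTransportLiteralSocket (bdd_of_l1env summable_rows_of_l1env)
open Summit.QuantumFields.BalabanUV.Beta.GAN24.TableSlotCoDress (vertexW_bmW_eq)
open Summit.QuantumFields.BalabanUV.Beta.GAN24.ChainTableLegCoClosed (push₃_legChain_table_eq_respStepBm_of_fluxFree)
open Summit.QuantumFields.BalabanUV.Beta.GAN24.CoDressedColumnPairing (summable_stencil_slot)

namespace Summit.QuantumFields.BalabanUV.Beta.GAN24.LayerTransportFluxFreeSocket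

variable {d : ℕ} {Lc : ℕ} [NeZero Lc]

/-! ## §1 The flux-free letter's chain of table legs = the undressed composite column on the co-dressed letter -/

/-- [folklore] **THE WINDOW MOVES ONTO THE LETTER, THREE-LEG FORM, POINTWISE** (`TableSlotCoDress.vertexW_bmW_eq` under `push₃_def`): for ANY kernel legs `l, r`, a table leg `w`
with summable fine rows and a local letter `S`, `push₃ l r (bmW ρ N w) S κ′ u′ = push₃ l r w (coProjBmAtK ρ N S) κ′ u′`. -/
theorem push₃_bmW_table_apply_eq {N : ℕ} (hN : 1 ≤ N) {r₀ : Fin (d + 1) → ℕ} (hr₀ : r₀ ∈ box (d + 1) N) (l r : LegFam d)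
    {w : Fin (d + 1) → (Fin (d + 1) → ℤ) → Fin (d + 1) → (Fin (d + 1) → ℤ) → ℝ} (hw : ∀ μ y κ, Summable (w μ y κ))
    {S : Fin (d + 1) → (Fin (d + 1) → ℤ) → MKer (d + 1) (Fib d)} {Cs δ : ℝ} (hS : LocStencil S Cs δ) (hδ : 0 ≤ δ)
    (κ' : Fin (d + 1)) (u' : Fin (d + 1) → ℤ) :
    push₃ l r (bmW (toSite r₀) N w) S κ' u' = push₃ l r w (coProjBmAtK (toSite r₀) N S) κ' u' := by
  have hV : Push4.vertexW (bmW (toSite r₀) N w) S κ' u' = Push4.vertexW w (coProjBmAtK (toSite r₀) N S) κ' u' := by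
    funext x z a b
    exact vertexW_bmW_eq hN hr₀ κ' u' (hw κ' u') x z a b (fun κ u => abs_le_of_locStencil hS hδ κ u x z a b)
  rw [push₃_def, push₃_def, hV]

/-- NOT IN PRINT; OUR BOOKKEEPING.  **ON A FLUX-FREE LOCAL LETTER THE DRESSED CHAIN OF TABLE LEGS IS THE UNDRESSED COMPOSITE COLUMN ACTING ON THE CO-DRESSED LETTER**:
`push₃ l r (legChain (respStepBmSeq ρ Lc) (m+1) k) S κ′ u′ = push₃ l r (respStep (Lc^(m+1)) (Lc^(m+1+k+1))) (coProjBmAtK ρ Lc S) κ′ u′` for ANY kernel legs — leaf-01 g67's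
`push₃_legChain_table_eq_respStepBm_of_fluxFree` (exactly the outermost dressing survives) ⨾ `respStepBm_def` ⨾ §1 (the window onto the letter); the undressed column's rows
are summable by its displayed (N1) envelope `hU0`. -/
theorem push₃_legChain_eq_respStep_coProj_of_fluxFree {rr : Fin (d + 1) → ℕ} (hrr : rr ∈ box (d + 1) Lc) (m k : ℕ)
    {P κ₀ : ℝ} (hκ₀ : 0 < κ₀)
    (hU0 : ∀ (μ : Fin (d + 1)) (z : Fin (d + 1) → ℤ) (l'' : Fin (d + 1)) (w' : Fin (d + 1) → ℤ),
      |respStep (d := d) (Lc ^ (m + 1)) (Lc ^ (m + 1 + k + 1)) μ z l'' w'| ≤ P * Real.exp (-κ₀ * l1 (quo (Lc ^ (k + 1)) w' - z)))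
    {S : Fin (d + 1) → (Fin (d + 1) → ℤ) → MKer (d + 1) (Fib d)} {Cs δ : ℝ} (hS : LocStencil S Cs δ) (hδ : 0 < δ)
    (hflux : ∀ Y : Site (d + 1), ∑ v ∈ box (d + 1) Lc, divV S ((Lc : ℤ) • Y + toSite v) = 0)
    (l r : LegFam d) (κ' : Fin (d + 1)) (u' : Fin (d + 1) → ℤ) :
    push₃ l r (legChain (respStepBmSeq (d := d) (toSite rr) Lc) (m + 1) k) S κ' u'
      = push₃ l r (respStep (d := d) (Lc ^ (m + 1)) (Lc ^ (m + 1 + k + 1))) (coProjBmAtK (toSite rr) Lc S) κ' u' := by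
  have hLc : 1 ≤ Lc := Nat.one_le_iff_ne_zero.2 (NeZero.ne Lc)
  have hL : 1 ≤ Lc ^ (k + 1) := Nat.one_le_pow _ _ (Nat.pos_of_ne_zero (NeZero.ne Lc))
  have hSs : ∀ κ x z a b, Summable fun u => S κ u x z a b := fun κ x z a b => summable_stencil_slot hS hδ κ x z a b
  rw [push₃_legChain_table_eq_respStepBm_of_fluxFree hrr (m + 1) k hSs hflux l r κ' u', respStepBm_def]
  exact push₃_bmW_table_apply_eq hLc hrr l r (summable_rows_of_l1env hL hκ₀ hU0) hS hδ.le κ' u'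

/-! ## §2 The literal's `hLT` for a flux-free sub-letter: the pure cell + two kernel cells on the co-dressed letter -/

section Three

variable {Lc : ℕ} [NeZero Lc]

/-- NOT IN PRINT; OUR BOOKKEEPING.  **ROW (CC-INT): THE FLUX-FREE SUB-LETTER's LAYER BOUND FROM (UUU) ON THE CO-DRESSED LETTER + TWO KERNEL ONE-GAUGE CELLS.**  `d = 3`,
`2 ≤ Lc`: there are `κ₀ > 0`, `A A′ A″ ≥ 0` (leaf-02's, level-free) such that for every `0 < κ ≤ κ₀`, every `(m, k)`, every local (`LocStencil S Csl m′`) letter `S` all of whose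
`Lc`-block fluxes vanish, whose CO-DRESSED letter `S̃ := coProjBmAtK ρ Lc S` meets the letter-side rows of the (LT-3) END at `κ` (profile `hS̃ ∕ hω`, charges `hQ hZ hM0 hP1`, centres
`hTl hTcard` — DISPLAYED, about `S̃`), and ANY constants `K₁ K₂` with the KERNEL one-gauge cells `push₃ (T−U) T U S̃`, `push₃ U (T−U) U S̃` bi-localised at `U₀` (DISPLAYED —
(ii-G)'s objects; undressed table leg), the literal's cubic push of `S` ITSELF satisfies the END's `hLT`: `BiLoc ((Lc^(k+1))^{12} • push₃ T T T S ν U₀) U₀ U₀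
((K₀ + K₁ + K₂)·(√(Lc^(k+1)))⁻¹·e^{−min(κ∕2,δ∕2)‖y−U₀‖₁}) (κ∕4)`, `K₀` the (UUU) cell's explicit constant, `T = legChain (respStepBmSeq ρ Lc) (m+1) k`, `U = respStep (Lc^(m+1)) (Lc^(m+1+k+1))`. -/
theorem exists_hLT_literal_of_kernel_cells_of_fluxFree (hLc : 2 ≤ Lc) {rr : Fin (3 + 1) → ℕ} (hrr : rr ∈ box (3 + 1) Lc) :
    ∃ κ₀ A A' A'' : ℝ, 0 < κ₀ ∧ 0 ≤ A ∧ 0 ≤ A' ∧ 0 ≤ A'' ∧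
      ∀ (m k : ℕ) (κ : ℝ), 0 < κ → κ ≤ κ₀ →
      ∀ (S : Fin (3 + 1) → (Fin (3 + 1) → ℤ) → MKer (3 + 1) (Fib 3)) (ω : (Fin (3 + 1) → ℤ) → ℝ)
        (Z : Fin (3 + 1) → Fin (3 + 1) → Fin (3 + 1) → (Fin (3 + 1) → ℤ) → (Fin (3 + 1) → ℤ) → ℝ) (T' : Finset (Fin (3 + 1) → ℤ))
        (Cs Csl m' δ B δZ ρ CT : ℝ), κ < m' → 0 < δ → 0 ≤ Cs → 0 ≤ B → 4 * κ < δZ →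
        LocStencil S Csl m' →
        (∀ Y : Fin (3 + 1) → ℤ, ∑ v ∈ box (3 + 1) Lc, divV S ((Lc : ℤ) • Y + toSite v) = 0) →
        -- the letter-side rows OF THE CO-DRESSED LETTER
        (∀ k' u x z a b, |coProjBmAtK (toSite rr) Lc S k' u x z a b| ≤ Cs * ω u * Real.exp (-m' * (l1 (x - u) + l1 (z - u)))) →
        ∀ (y : Fin (3 + 1) → ℤ),
        (∀ u, 0 ≤ ω u ∧ ω u ≤ ∑ μ : Fin (3 + 1),
          (∑ v ∈ ((box (3 + 1) (Lc ^ (k + 1))).filter (fun v => v μ = Lc ^ (k + 1) - 1)).image (fun v => ((Lc ^ (k + 1) : ℕ) : ℤ) • y + toSite v),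
              Real.exp (-δ * l1 (v - u))
            + ∑ v ∈ ((box (3 + 1) (Lc ^ (k + 1))).filter (fun v => v μ = 0)).image (fun v => ((Lc ^ (k + 1) : ℕ) : ℤ) • y + toSite v - unitVec μ),
                Real.exp (-δ * l1 (v - u)))) →
        (∀ k' κ₁ κ₂ u, ∑' x, ∑' z, coProjBmAtK (toSite rr) Lc S k' u x z (Sum.inl κ₁) (Sum.inl κ₂) = ∑ y' ∈ T', Z k' κ₁ κ₂ y' u) →
        (∀ k' κ₁ κ₂, ∀ y' ∈ T', ∀ e, |Z k' κ₁ κ₂ y' e| ≤ B * Real.exp (-δZ * l1 (e - y'))) →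
        (∀ k' κ₁ κ₂, ∀ y' ∈ T', ∑' e, Z k' κ₁ κ₂ y' e = 0) →
        (∀ k' κ₁ κ₂, ∀ y' ∈ T', ∀ i : Fin (3 + 1), ∑' e, (((e - y') i : ℤ) : ℝ) * Z k' κ₁ κ₂ y' e = 0) →
        (∀ y' ∈ T', l1 (quo (Lc ^ (k + 1)) y' - y) ≤ ρ) → ((T'.card : ℝ) ≤ CT * (((Lc ^ (k + 1) : ℕ) : ℝ)) ^ (3 + 1)) →
        ∀ (K₁ K₂ : ℝ) (ν : Fin (3 + 1)) (U₀ : Fin (3 + 1) → ℤ),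
        -- the two KERNEL one-gauge cells on the co-dressed letter, undressed table leg
        BiLoc (((((Lc ^ (k + 1) : ℕ) : ℝ)) ^ (3 * (3 + 1))) •
            push₃ (legChain (respStepBmSeq (d := 3) (toSite rr) Lc) (m + 1) k - respStep (d := 3) (Lc ^ (m + 1)) (Lc ^ (m + 1 + k + 1)))
              (legChain (respStepBmSeq (d := 3) (toSite rr) Lc) (m + 1) k) (respStep (d := 3) (Lc ^ (m + 1)) (Lc ^ (m + 1 + k + 1)))
              (coProjBmAtK (toSite rr) Lc S) ν U₀) U₀ U₀
          (K₁ * ((Real.sqrt (((Lc ^ (k + 1) : ℕ) : ℝ)))⁻¹ * Real.exp (-(min (κ / 2) (δ / 2)) * l1 (y - U₀)))) (κ / 4) →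
        BiLoc (((((Lc ^ (k + 1) : ℕ) : ℝ)) ^ (3 * (3 + 1))) •
            push₃ (respStep (d := 3) (Lc ^ (m + 1)) (Lc ^ (m + 1 + k + 1)))
              (legChain (respStepBmSeq (d := 3) (toSite rr) Lc) (m + 1) k - respStep (d := 3) (Lc ^ (m + 1)) (Lc ^ (m + 1 + k + 1)))
              (respStep (d := 3) (Lc ^ (m + 1)) (Lc ^ (m + 1 + k + 1))) (coProjBmAtK (toSite rr) Lc S) ν U₀) U₀ U₀
          (K₂ * ((Real.sqrt (((Lc ^ (k + 1) : ℕ) : ℝ)))⁻¹ * Real.exp (-(min (κ / 2) (δ / 2)) * l1 (y - U₀)))) (κ / 4) →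
        BiLoc (((((Lc ^ (k + 1) : ℕ) : ℝ)) ^ (3 * (3 + 1))) •
            push₃ (legChain (respStepBmSeq (d := 3) (toSite rr) Lc) (m + 1) k) (legChain (respStepBmSeq (d := 3) (toSite rr) Lc) (m + 1) k)
              (legChain (respStepBmSeq (d := 3) (toSite rr) Lc) (m + 1) k) S ν U₀) U₀ U₀
          (((((((3 : ℝ) + 1) ^ 3 * A ^ 2 * A' * Cs * (2 / (m' - κ) * Zl (3 + 1) ((m' - κ) / 2)) * (Zl (3 + 1) (m' - κ) + Zl (3 + 1) m'))
            * ((2 * ((3 : ℝ) + 1)) ^ 2 * Zl (3 + 1) (δ / 2) * Real.exp (min (κ / 2) (δ / 2))))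
        + ((3 : ℝ) + 1) ^ 3 *
          ((((A'' * A * A + 2 * A' * A' * A + A * A'' * A) * Real.exp (2 * κ) + 2 * ((A' * A + A * A') * Real.exp κ) * A' + A * A * A'')
              * Real.exp (2 * (2 * κ))) * B * (8 / (δZ - 2 * (2 * κ)) ^ 2 * Zl (3 + 1) ((δZ - 2 * (2 * κ)) / 4)) * Real.exp ((κ / 2) * ρ) * CT))
            + K₁ + K₂) * ((Real.sqrt (((Lc ^ (k + 1) : ℕ) : ℝ)))⁻¹ * Real.exp (-(min (κ / 2) (δ / 2)) * l1 (y - U₀)))) (κ / 4) := by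
  obtain ⟨κ₀, A, A', A'', hκ₀, hA, hA', hA'', h0, h1, h2⟩ := exists_respStep_decay_grad_diff2_l1 (Lc := Lc)
  obtain ⟨κ₁, KT, hκ₁, hKT, hT⟩ := exists_legChain_envelope (Lc := Lc) hLc
  refine ⟨κ₀, A, A', A'', hκ₀, hA, hA', hA'', ?_⟩
  intro m k κ hκ hκκ₀ S ω Z T' Cs Csl m' δ B δZ ρ CT hm hδ hCs hB hκδZ hSl hflux hS y hω hQ hZ hM0 hP1 hTl hTcard K₁ K₂ ν U₀ h₁ h₂
  have hLc1 : 1 ≤ Lc := Nat.one_le_iff_ne_zero.2 (NeZero.ne Lc)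
  have hL : 1 ≤ Lc ^ (k + 1) := Nat.one_le_pow _ _ (Nat.pos_of_ne_zero (NeZero.ne Lc))
  have hm' : 0 < m' := hκ.trans hm
  -- names
  set T : LegFam 3 := legChain (respStepBmSeq (d := 3) (toSite rr) Lc) (m + 1) k with hTdef
  set U : LegFam 3 := respStep (d := 3) (Lc ^ (m + 1)) (Lc ^ (m + 1 + k + 1)) with hUdef
  set St := coProjBmAtK (toSite rr) Lc S with hSt
  set c : ℝ := ((((Lc ^ (k + 1) : ℕ) : ℝ)) ^ (3 * (3 + 1))) with hc
  set W : ℝ := (Real.sqrt (((Lc ^ (k + 1) : ℕ) : ℝ)))⁻¹ * Real.exp (-(min (κ / 2) (δ / 2)) * l1 (y - U₀)) with hW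
  -- the co-dressed letter is local (an2)
  have hStl : LocStencil St (cKb' 3 Lc m' * Csl) m' := locStencil_coProjBmAtK hLc1 hrr hSl hm'.le
  -- (1) the flux-free letter's chain of table legs = the undressed composite column on the co-dressed letter
  have e1 : push₃ T T T S ν U₀ = push₃ T T U St ν U₀ :=
    push₃_legChain_eq_respStep_coProj_of_fluxFree hrr m k (P := A * ((((Lc ^ (k + 1) : ℕ) : ℝ)) ^ (3 + 2))⁻¹) hκ₀ (h0 (m + 1) k) hSl hm' hflux T T ν U₀
  -- side conditions of the summable class
  have hTenv := hT rr hrr (m + 1) k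
  have hTb : ∀ α x' κ' x, |T α x' κ' x| ≤ KT * ((Lc : ℝ) ^ (4 * (k + 1)))⁻¹ := abs_le_of_env' hκ₁.le hTenv
  have hTs : ∀ α x' κ', Summable fun x => T α x' κ' x := summable_of_env' hL hκ₁ hTenv
  have hP : 0 ≤ A * ((((Lc ^ (k + 1) : ℕ) : ℝ)) ^ (3 + 2))⁻¹ := by positivity
  have hUb : ∀ α x' κ' x, |U α x' κ' x| ≤ A * ((((Lc ^ (k + 1) : ℕ) : ℝ)) ^ (3 + 2))⁻¹ := bdd_of_l1env hP hκ₀.le (h0 (m + 1) k)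
  have hUs : ∀ α x' κ', Summable fun x => U α x' κ' x := summable_rows_of_l1env hL hκ₀ (h0 (m + 1) k)
  -- (2) telescope in the two KERNEL legs (table leg fixed = U)
  have eL := push₃_sub_left (l := T) (l' := U) (r := T) (w := U) hTb hTs hUb hUs hTs hUb hStl hm' ν U₀
  have eR := push₃_sub_right (l := U) (r := T) (r' := U) (w := U) hUb hTs hUs hUb hStl hm' ν U₀
  have e2 : push₃ T T U St ν U₀ = push₃ U U U St ν U₀ + push₃ (T - U) T U St ν U₀ + push₃ U (T - U) U St ν U₀ := by
    rw [eL, eR]; abel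
  -- (3) the pure cell on the co-dressed letter (leaf-01's (UUU), leg rows discharged)
  have h₀ := biLoc_cubic_push₃_respStep_three m k hκ hκκ₀ hA hA' hA'' (h0 (m + 1) k) (h1 (m + 1) k) (h2 (m + 1) k)
    hm hδ hCs hB hκδZ hS y hω hQ hZ hM0 hP1 hTl hTcard ν U₀
  have h₀' : BiLoc (c • push₃ U U U St ν U₀) U₀ U₀
      (((((((3 : ℝ) + 1) ^ 3 * A ^ 2 * A' * Cs * (2 / (m' - κ) * Zl (3 + 1) ((m' - κ) / 2)) * (Zl (3 + 1) (m' - κ) + Zl (3 + 1) m'))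
            * ((2 * ((3 : ℝ) + 1)) ^ 2 * Zl (3 + 1) (δ / 2) * Real.exp (min (κ / 2) (δ / 2))))
        + ((3 : ℝ) + 1) ^ 3 *
          ((((A'' * A * A + 2 * A' * A' * A + A * A'' * A) * Real.exp (2 * κ) + 2 * ((A' * A + A * A') * Real.exp κ) * A' + A * A * A'')
              * Real.exp (2 * (2 * κ))) * B * (8 / (δZ - 2 * (2 * κ)) ^ 2 * Zl (3 + 1) ((δZ - 2 * (2 * κ)) / 4)) * Real.exp ((κ / 2) * ρ) * CT))) * W) (κ / 4) :=
    fun x z a b => (h₀ x z a b).trans (le_of_eq (by rw [hW]; ring))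
  -- (4) assemble
  rw [e1, e2, smul_add, smul_add]
  have e3 : ((((((3 : ℝ) + 1) ^ 3 * A ^ 2 * A' * Cs * (2 / (m' - κ) * Zl (3 + 1) ((m' - κ) / 2)) * (Zl (3 + 1) (m' - κ) + Zl (3 + 1) m'))
            * ((2 * ((3 : ℝ) + 1)) ^ 2 * Zl (3 + 1) (δ / 2) * Real.exp (min (κ / 2) (δ / 2))))
        + ((3 : ℝ) + 1) ^ 3 *
          ((((A'' * A * A + 2 * A' * A' * A + A * A'' * A) * Real.exp (2 * κ) + 2 * ((A' * A + A * A') * Real.exp κ) * A' + A * A * A'')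
              * Real.exp (2 * (2 * κ))) * B * (8 / (δZ - 2 * (2 * κ)) ^ 2 * Zl (3 + 1) ((δZ - 2 * (2 * κ)) / 4)) * Real.exp ((κ / 2) * ρ) * CT))
            + K₁ + K₂) * W
      = ((((((3 : ℝ) + 1) ^ 3 * A ^ 2 * A' * Cs * (2 / (m' - κ) * Zl (3 + 1) ((m' - κ) / 2)) * (Zl (3 + 1) (m' - κ) + Zl (3 + 1) m'))
            * ((2 * ((3 : ℝ) + 1)) ^ 2 * Zl (3 + 1) (δ / 2) * Real.exp (min (κ / 2) (δ / 2))))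
        + ((3 : ℝ) + 1) ^ 3 *
          ((((A'' * A * A + 2 * A' * A' * A + A * A'' * A) * Real.exp (2 * κ) + 2 * ((A' * A + A * A') * Real.exp κ) * A' + A * A * A'')
              * Real.exp (2 * (2 * κ))) * B * (8 / (δZ - 2 * (2 * κ)) ^ 2 * Zl (3 + 1) ((δZ - 2 * (2 * κ)) / 4)) * Real.exp ((κ / 2) * ρ) * CT))) * W
        + K₁ * W + K₂ * W := by ring
  rw [e3]
  exact biLoc_add (biLoc_add h₀' h₁) h₂

end Three

end Summit.QuantumFields.BalabanUV.Beta.GAN24.LayerTransportFluxFreeSocket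

end
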